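import Literature.MathematicalPhysics.QuantumFieldTheory.Balaban1983to89.B8SockHFPWindows
import HarnessLib

/-!
# Line H (`BirthV10.stub_halvingStep`, stmt-QuantumFields-19200), v6 «STEP-LEAF» part 1∕2: THE JOIN's 26-ROW WINDOW CONJUNCTION `hwin` FROM THE HARVEST ROWS
# (+ the three non-harvest rows 20∕26∕27 as ONE named input `hW3`)

Cell `ym3-torus` (HUMAN RULING D-0037: YM₃ on T³ is ladder rung R3 — NOT d = 4, NOT a mass gap, NOT the Clay problem), width seat `ym-ust-19936-w2` gen 9 on LEAD-H
★w5-19200 g6's row «STEP-LEAF» (22:35:13Z; WORD 11: «type the plumbing with `hMcKc` as the one named input»).  `--supports stmt-QuantumFields-19200 --as helper`;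
THEOREMS ONLY (0 `def`, 0 `sorry`); count-neutral; nothing here claims `hT4TL`, `hSockets₂'`, the stub, the crux or the gap; the YM gap is NOT proved.

THE POINT.  ★w3-19200 g9's FILE C ★★★`hT4T_of_leafSocketsB9` (Theorem 4's datum per member from the LEAF sockets `SLetτAll ∧ SB9all`) displays the JOIN's scalar windows
`hwin` = lit ✓`B8SockHFPWindows.hfpWindows_of_guard`'s 26-row conclusion VERBATIM (letters `cs α₄ cB cDA hE hE₂ lE lE₂` bound by eight equations, `cDA = 2·d·L²·cs`).
At the ρ4 member the only smallness is `hw`, harvested by ✓p655819 `HalvingHSupURhoWindowsRho3.exists_topCall_constants_of_rhoWindow₃`; this file is the LETTER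
BRIDGE: ★`hwin_of_harvestRows (d L) … : <hwin VERBATIM at (F.P K).d ↦ d, (F.P K).L ↦ L>` from the harvest's rows in ITS letters (`cstar α₄ C₂ cB cA Cb` with the
equations `ec e4 eC ecB ecA`, group (2) `hα3 hα4 hC₂`, group (3) rows, group (5) at `τ := 0` through `hE ≤ B₀'H·Cb` ⟸ the (3) floor `C2p d (40dcB+α₄)α₄ ≤ Cb`) plus
ONE named input `hW3` = the three rows the harvest does NOT carry (my LOCATE #1 + erratum, bus 22:48∕22:57Z): row 20 `40dcB + α₄ ≤ 1∕(4B₀'H·2C2p d)` (harvest: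
factor 4 short) and rows 26–27 (`Mc`∕`Kc` at `cDA = 2·d·L²·cstar`; harvest: `d·L²·cstar`) — supplied by ym-ust-19936-w7 g9's (E2) «HARVEST-2CDA» lemma.  Part 2∕2
(`hSockets₂'_of_leafSockets`) calls this at `d := (F.P K).d`, `L := (F.P K).L` after the harvest `obtain` and the letter `subst`s of ✓p674236's pattern.
HONEST SCOPE: scalar bookkeeping (22 rows by name, 2 by `C₂`'s equation, 3 by linear monotonicity); nothing of [Balaban1985RegularSpaces] is asserted.

References: T. Bałaban, CMP **99** (1985) 75–102 [Balaban1985RegularSpaces] (Prop. 3 (1.36)–(1.42) pp.82–83, Prop. 5 (1.106)–(1.109) p.94).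
-/

set_option autoImplicit false

noncomputable section

namespace Summit.QuantumFields.YangMills.Theorems.HalvingHSockets2OfLeafSockets

open Literature.MathematicalPhysics.QuantumFieldTheory.Balaban1983to89
open B7Prop2Explicit (C0 c2')
open B7Prop3Flat (c3)
open B7Prop10General (C6 C4G)
open B7Prop9Flat (C5')
open B8Ineq125Concrete (C2p)
open B8Prop5ContractionKLevel (Mc Kc)

/-- ★ **THE JOIN's `hwin` FROM THE HARVEST ROWS + `hW3`** (see the module docstring): conclusion = FILE C's `hwin` binder VERBATIM at generic `d L`.
[cite: Balaban1985RegularSpaces, (1.36)-(1.42) pp.82-83, (1.106)-(1.109) p.94] -/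
theorem hwin_of_harvestRows (d L : ℕ) {ε₀ α₁ B₀ B₀' B₀'H B₂' BG BR cB9 cstar α₄ C₂ cB cA Cb : ℝ}
    (hB₀'H : 0 < B₀'H)
    (ec : cstar = 5 * (d : ℝ) * L * B₀ * (ε₀ + α₁)) (e4 : α₄ = 8 * B₀' * (5 * (d : ℝ) * L * B₀) * (ε₀ + α₁))
    (eC : C₂ = 16 * (131072 * ((d : ℝ) + 1) ^ 2)) (ecB : cB = L * cstar) (ecA : cA = L * cstar)
    (hα3 : C0 d * ε₀ ≤ 1 / 3) (hα4 : 4 * ε₀ ≤ c2' d L)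
    (hC₂ : 8 * (131072 * ((d : ℝ) + 1) ^ 2) * Real.exp (4 * (800 * ((d : ℝ) + 1) ^ 2 * ((d : ℝ) + 4)) * ε₀) ≤ C₂)
    (hε9 : ε₀ ≤ cB9) (hcs9 : cstar ≤ cB9) (h36 : 36 * d * B₀ * cstar ≤ 1 / 2)
    (h2cs : 2 * cstar ^ 2 + 20 * d * ε₀ * cstar + 2 * C₂ * cstar ^ 2 ≤ ε₀ + α₁) (hsmall₁ : (d : ℝ) * L * α₁ ≤ 1 / 8)
    (hexpcB : Real.exp (4 * (800 * ((d : ℝ) + 1) ^ 2 * ((d : ℝ) + 4)) * ε₀) * (1 + 8 * (131072 * ((d : ℝ) + 1) ^ 2) * cB) ≤ 2)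
    (hc3cB : 2 * cB ≤ c3 d L) (h2048 : 2048 * (d : ℝ) * cB ≤ 1) (h40d : 40 * d * cB ≤ 1 / 200)
    (h200C6 : 200 * C6 d * (2 * α₄) ≤ 1) (h12000 : 12000 * ((d : ℝ) + 1) * L * (2 * α₄) ≤ 1)
    (hC4G : C4G d L * (ε₀ + 40 * d * cB + 4 * (2 * α₄)) ≤ 1)
    (h1024 : 1024 * ((d : ℝ) + 1) * ((d : ℝ) + 4) * (L : ℝ) ^ 2 * ε₀ ≤ 1) (h32 : 32 * ((d : ℝ) + 1) ^ 2 * C6 d * (L : ℝ) ^ 2 * ε₀ ≤ 1)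
    (h16d : 16 * d * C5' d * C6 d * (L : ℝ) ^ 2 * ε₀ ≤ 1) (h8d : 8 * d * C6 d * L * ε₀ ≤ 1)
    (h2C6 : 2 * C6 d * (40 * d * cB + 4 * α₄) ≤ 1 / 8) (hcA13 : cA ≤ 1 / 13)
    (hCbfl : C2p d * (40 * d * cB + α₄) * α₄ ≤ Cb)
    (h5a : α₄ / 4 + B₀'H * (Cb + 0) ≤ 1 / 24) (h5b : α₄ / 4 + B₀'H * (Cb + 0) ≤ 1 / 140) (h5c : 10 * (α₄ / 4 + B₀'H * (Cb + 0)) * BR ≤ 1 / 2)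
    (hBR : 0 ≤ BR)
    (hW3 : (40 * d * (L * cstar) + α₄ ≤ 1 / (4 * B₀'H * (2 * C2p d))) ∧
        (BG * Mc d BR (α₄ / 4 + B₀'H * (C2p d * (40 * d * (L * cstar) + α₄) * α₄)) (L * cstar)
          (B₂' * (C2p d * (40 * d * (L * cstar) + α₄) * α₄)) (2 * (d : ℝ) * (L : ℝ) ^ 2 * cstar) ≤ α₄ / 4) ∧
        (BG * Kc d BR (α₄ / 4 + B₀'H * (C2p d * (40 * d * (L * cstar) + α₄) * α₄)) (L * cstar)
          (B₂' * (C2p d * (40 * d * (L * cstar) + α₄) * α₄)) (2 * (d : ℝ) * (L : ℝ) ^ 2 * cstar)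
          (B₂' * (4 * C2p d * (40 * d * (L * cstar) + 2 * α₄))) (1 + B₀'H * (4 * C2p d * (40 * d * (L * cstar) + 2 * α₄)))
          (1 + B₀'H * (4 * C2p d * (40 * d * (L * cstar) + 2 * α₄))) ≤ 1 / 2)) :
    ∀ cs α₄' cB cDA hE hE₂ lE lE₂ : ℝ, cs = 5 * (d : ℝ) * L * B₀ * (ε₀ + α₁) → α₄' = 8 * B₀' * (5 * (d : ℝ) * L * B₀) * (ε₀ + α₁) →
      cB = L * cs → cDA = 2 * (d : ℝ) * (L : ℝ) ^ 2 * cs →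
      hE = B₀'H * (C2p d * (40 * d * cB + α₄') * α₄') → hE₂ = B₂' * (C2p d * (40 * d * cB + α₄') * α₄') →
      lE = B₀'H * (4 * C2p d * (40 * d * cB + 2 * α₄')) → lE₂ = B₂' * (4 * C2p d * (40 * d * cB + 2 * α₄')) →
      36 * d * B₀ * cs ≤ 1 / 2 ∧
      8 * (131072 * ((d : ℝ) + 1) ^ 2) * Real.exp (4 * (800 * ((d : ℝ) + 1) ^ 2 * ((d : ℝ) + 4)) * ε₀) ≤ 16 * (131072 * ((d : ℝ) + 1) ^ 2) ∧
      2 * cs ^ 2 + 20 * d * ε₀ * cs + 2 * (16 * (131072 * ((d : ℝ) + 1) ^ 2)) * cs ^ 2 ≤ ε₀ + α₁ ∧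
      (d : ℝ) * L * α₁ ≤ 1 / 8 ∧
      ε₀ ≤ cB9 ∧ cs ≤ cB9 ∧
      C0 d * ε₀ ≤ 1 / 3 ∧ 4 * ε₀ ≤ c2' d L ∧
      Real.exp (4 * (800 * ((d : ℝ) + 1) ^ 2 * ((d : ℝ) + 4)) * ε₀) * (1 + 8 * (131072 * ((d : ℝ) + 1) ^ 2) * cB) ≤ 2 ∧
      2 * cB ≤ c3 d L ∧ 2048 * (d : ℝ) * cB ≤ 1 ∧ 40 * d * cB ≤ 1 / 200 ∧
      200 * C6 d * (2 * α₄') ≤ 1 ∧ 12000 * ((d : ℝ) + 1) * L * (2 * α₄') ≤ 1 ∧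
      C4G d L * (ε₀ + 40 * d * cB + 4 * (2 * α₄')) ≤ 1 ∧
      1024 * ((d : ℝ) + 1) * ((d : ℝ) + 4) * L ^ 2 * ε₀ ≤ 1 ∧ 32 * ((d : ℝ) + 1) ^ 2 * C6 d * L ^ 2 * ε₀ ≤ 1 ∧
      16 * d * C5' d * C6 d * (L : ℝ) ^ 2 * ε₀ ≤ 1 ∧ 8 * d * C6 d * L * ε₀ ≤ 1 ∧
      40 * d * cB + α₄' ≤ 1 / (4 * B₀'H * (2 * C2p d)) ∧ 2 * C6 d * (40 * d * cB + 4 * α₄') ≤ 1 / 8 ∧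
      cB ≤ 1 / 13 ∧ α₄' / 4 + hE ≤ 1 / 24 ∧ α₄' / 4 + hE ≤ 1 / 140 ∧ 10 * (α₄' / 4 + hE) * BR ≤ 1 / 2 ∧
      BG * Mc d BR (α₄' / 4 + hE) cB hE₂ cDA ≤ α₄' / 4 ∧
      BG * Kc d BR (α₄' / 4 + hE) cB hE₂ cDA lE₂ (1 + lE) (1 + lE) ≤ 1 / 2 := by
  intro cs α₄'' cB'' cDA'' hE hE₂ lE lE₂ hcs hα₄'' hcB'' hcDA'' hhE hhE₂ hlE hlE₂
  have ecs : cs = cstar := by rw [hcs, ec]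
  subst ecs
  have eα₄ : α₄'' = α₄ := by rw [hα₄'', e4]
  subst eα₄
  subst hcB''
  subst hcDA''
  subst hhE
  subst hhE₂
  subst hlE
  subst hlE₂
  subst ecB
  subst ecA
  have hEle : B₀'H * (C2p d * (40 * d * (L * cs) + α₄'') * α₄'') ≤ B₀'H * Cb := mul_le_mul_of_nonneg_left hCbfl hB₀'H.le
  rw [add_zero] at h5a h5b h5c
  refine ⟨h36, ?_, ?_, hsmall₁, hε9, hcs9, hα3, hα4, hexpcB, hc3cB, h2048, h40d, h200C6, h12000, hC4G, h1024, h32, h16d, h8d, hW3.1, h2C6, hcA13,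
    ?_, ?_, ?_, hW3.2.1, hW3.2.2⟩
  · rw [← eC]; exact hC₂
  · rw [← eC]; exact h2cs
  · linarith
  · linarith
  · have h10 : 0 ≤ 10 * BR := by positivity
    nlinarith [mul_le_mul_of_nonneg_right hEle h10]

end Summit.QuantumFields.YangMills.Theorems.HalvingHSockets2OfLeafSockets

end
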